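import Summits.BirchSwinnertonDyer.BirchSwinnertonDyer.Theorems.QuadraticBranchSignedControlPlusEtaNonsurjThetaFunctionalEquationNormCoordinateFactorisation
import Summits.BirchSwinnertonDyer.BirchSwinnertonDyer.Theorems.DefiniteThetaDerivedHeightCapIwasawaSerreLevel
import HarnessLib

/-!
# Route `QuadraticBranchSignedControl` (rung K8, cell `bsd-potss`), residual crux `PlusEtaMainConjectureNonsurj`
# (stmt-BirchSwinnertonDyer-19606): THE FUNCTIONAL EQUATION ON THE QUADRATIC BRANCH, XXXV — THE FUNCTIONAL-EQUATION SQUEEZE IN THE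
# NORM COORDINATE: **`L = u·T^r·(1+T)^k H(Z)` with `H ∈ ℤ_p[Z]` IRREDUCIBLE, `T^r ∣ g ∣ L`, `(ιg) = (g)`, `p ∣ coeff_r g` ⟹ `(g) = (L)`** —
# the `hshape` brick of crux 19601's squeeze (k8eta-c1 g11) WITHOUT `ℤ_p`-RATIONAL ZEROS, for every degree `k`; and off the onto locus
# (`g ∣ pⁿL`, one algebraic zero pair) **`(g) = p^{μ(g)}·(L)`** (seat `bsd-potss-k8eta-c2` g31; kernel, generic `Λ`-algebra, fact-free)

WHY. Crux 19601's functional-equation squeeze (`…PlusEtaLowerInclusionFunctionalEquationSqueeze`, k8eta-c1 g11) closes (E⁺_η) ∧ (C1⁺_η) at a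
tower-onto pair from: Kato (`g ∣ Lη`), the rank bound (`T^r ∣ g`), ONE algebraic factor of `p` (`p ∣ coeff_r g`), Kim 3.11η (`(ιg) = (g)`) and
the ANALYTIC SHAPE `hshape`: `Lη = u·T^r·(T − c₁)(T − c₂)` with `c₁, c₂ ∈ pℤ_p ∖ {0}` — i.e. `λ = r + 2` AND the two extra zeros `ℤ_p`-RATIONAL.
g30's census (P-30Z/P-30L, Part XXVIII `isSquare_add_of_shape_plus_row`) showed that on 12 of the 19 level-4 rows with `λ = r₀ + 2` the
quadratic `T² + aT + a` is IRREDUCIBLE over `ℚ_5` (`v_5(a) = 1`): there `hshape` is VOID although nothing about the squeeze needs rationality.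
In the norm coordinate the brick needs only `H_an` IRREDUCIBLE in `ℤ_p[Z]` (Parts XXXII–XXXIV): the Kato reading gives `H_alg ∣ H_an`, hence
`H_alg ∈ {1, H_an}`; `T^r ∣ g` and `ord g ≤ ord L = r` give `ord g = r`; `μ(g) = 0`; and `p ∣ coeff_r g = H_alg(0)·unit` excludes `H_alg = 1`.
So **`(g) = (L)` for `L = u·T^r·(1+T)^k·H(Z)`, `H` distinguished irreducible with `H(0) ≠ 0`, ANY `k ≥ 1`** — at `k = 1` this is the shape
`Lη = u·T^r·(T² + aT + a)`, `a ∈ pℤ_p ∖ {0}` (ALL 19 `k = 1` rows, rational or not; `hshape` ⟹ it with `a = c₁c₂ = −(c₁ + c₂)`), and at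
`k ≥ 2` every Eisenstein row (`p² ∤ h₀`) and every residual-discriminant row of Part XXXIV. Off the onto locus (crux 19606's rows: Kato with
slack `pⁿ`, Part XXXIII) the `μ`-bookkeeping is lost but not the polynomial: with ONE algebraic zero pair (`λ(g) > ord g`) in place of the digit,
**`ord g = r`, `λ(g) = r + 2k`, and `(g) = (p^{μ(g)}·L)`, `μ(g) ≤ n`** — the main conjecture at the row UP TO `μ`.

MATHEMATICS. Datum of `L`: `m = 0`, `P_L = T^r·normPoly(H)`, `U = u`; `ord L = r` since `H(0) ≠ 0`. Datum of `g` (Part XVI) and its norm form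
(Part XXVII, from `(ιg) = (g)`). Part XXXII `normForm_dvd_C_pow_mul_iff`: `μ(g) ≤ n`, `ord g ≤ r`, `H_g ∣ H`; `T^r ∣ g` ⟹ `ord g ≥ r`; Part XXXIV
`eq_one_or_eq_of_monic_dvd_irreducible`; Part XXX `coeff_order_eq_of_normForm`: `coeff_r g = p^{μ(g)}·H_g(0)·U_g(0)`; `p ∉ ℤ_pˣ`; Part XXXII
`normForm_span_eq_iff` / `lam_of_weierstrass`; `TowerSqrt.not_isUnit_p` (`p ∉ ℤ_pˣ`).

WHAT (8 theorems). §105 `coeff_normShape`, `order_normShape`, `normShape_ne_zero`, **`span_eq_of_normShape_of_irreducible`**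
(onto locus: `(g) = (L)`), **`span_eq_C_pow_mul_of_normShape_of_irreducible_of_lt_lam`** (slack `pⁿ`: `(g) = (p^{μ(g)}L)`); §106 (`k = 1`)
`isDistinguishedAt_X_add_C`, `one_add_X_mul_subst_X_add_C` (`(1+T)(Z + a) = T² + aT + a`), **`span_eq_of_quadraticShape`**
(`Lη = u·T^r·(T² + aT + a)`, `a ∈ pℤ_p ∖ {0}` ⟹ `(g) = (Lη)`; no `c₁, c₂`). The crux-19601 road with this shape is Part XXXVI.

HONEST FRAMING (cell `bsd-potss`; FULL-BSD rank ≤ 1 programme, HUMAN RULING D-0036/D-0074): TOOL THEOREMS ONLY — pure commutative algebra of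
`Λ = ℤ_p⟦T⟧`; no definition, no named fact, no `sorry`, axioms standard; nothing about (A), (C1⁺_η), (E⁺_η), C-cc-1 or `BSD(W,p)` of any pair
is claimed; no stub of 19606 / 19601 is proved; cruxes and route OPEN; nothing booked. `--supports stmt-BirchSwinnertonDyer-19606`.

References: [Washington1997] §7.1 (Thm. 7.3), §13.2; [KimBD2008MRL] Thm. 3.11 (p. 93); [Kobayashi2003] Thm. 4.1 (p. 8); [GreenbergLNM1716] §1
(pp. 67–68); [MazurTateTeitelbaum1986Invent] §I.17. Tree: Parts XVI, XXVII, XXX, XXXII–XXXIV; `…PlusEtaLowerInclusionFunctionalEquationSqueezeAlgebra`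
(`span_singleton_eq_of_invol_of_feShape`, the rational-zero special case).
-/

set_option autoImplicit false
set_option linter.dupNamespace false
noncomputable section

open scoped Classical Topology

open PowerSeries Literature.NumberTheory.EllipticCurves Literature.NumberTheory.EllipticCurves.IwasawaAlgebra
open Summit.BirchSwinnertonDyer.Rank1Residual.X1.MuLambda (mu lam)

namespace Summit.BirchSwinnertonDyer.BirchSwinnertonDyer.Theorems.EtaThetaFunctionalEquation

variable {p : ℕ} [hp : Fact p.Prime] {r : ℤ_[p]} {S Z : IwasawaAlgebra p}

/-! ## §105 The squeeze brick: `L = u·T^{r₀}·(1+T)^k·H(Z)`, `H` irreducible -/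

/-- `coeff_{r₀}(u·T^{r₀}·(1+T)^k·G(Z)) = u(0)·G(0)`. [cite: Washington1997, §7.1] -/
theorem coeff_normShape (hZ : Z = X + invol p X) (u G : IwasawaAlgebra p) (r₀ k : ℕ) :
    coeff r₀ (u * X ^ r₀ * ((1 + X) ^ k * PowerSeries.subst Z G)) = constantCoeff u * constantCoeff G := by
  rw [show u * X ^ r₀ * ((1 + X) ^ k * PowerSeries.subst Z G) = X ^ r₀ * (u * ((1 + X) ^ k * PowerSeries.subst Z G)) by ring,
    coeff_X_pow_mul', if_pos le_rfl, Nat.sub_self, coeff_zero_eq_constantCoeff, map_mul, map_mul, map_pow, map_add, map_one,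
    constantCoeff_X, add_zero, one_pow, one_mul, constantCoeff_subst_trace hZ]

/-- `ord_T(u·T^{r₀}·(1+T)^k·H(Z)) = r₀` for `u ∈ Λˣ` and `H(0) ≠ 0`. [cite: Washington1997, §7.1] -/
theorem order_normShape (hZ : Z = X + invol p X) {u : IwasawaAlgebra p} (hu : IsUnit u) {H : Polynomial ℤ_[p]} (hH0 : H.coeff 0 ≠ 0)
    (r₀ k : ℕ) : PowerSeries.order (u * X ^ r₀ * ((1 + X) ^ k * PowerSeries.subst Z (H : IwasawaAlgebra p))) = r₀ := by
  have hH0' : constantCoeff (H : IwasawaAlgebra p) ≠ 0 := by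
    rwa [← coeff_zero_eq_constantCoeff_apply, Polynomial.coeff_coe]
  refine order_eq_nat.mpr ⟨?_, fun i hi ↦ ?_⟩
  · rw [coeff_normShape hZ]
    exact mul_ne_zero (fun h ↦ (PowerSeries.isUnit_iff_constantCoeff.mp hu).ne_zero h) hH0'
  · rw [show u * X ^ r₀ * ((1 + X) ^ k * PowerSeries.subst Z (H : IwasawaAlgebra p)) =
        X ^ r₀ * (u * ((1 + X) ^ k * PowerSeries.subst Z (H : IwasawaAlgebra p))) by ring, coeff_X_pow_mul', if_neg (not_le.mpr hi)]

/-- `u·T^{r₀}·(1+T)^k·H(Z) ≠ 0` (`u ∈ Λˣ`, `H(0) ≠ 0`). [cite: Washington1997, §7.1] -/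
theorem normShape_ne_zero (hZ : Z = X + invol p X) {u : IwasawaAlgebra p} (hu : IsUnit u) {H : Polynomial ℤ_[p]} (hH0 : H.coeff 0 ≠ 0)
    (r₀ k : ℕ) : u * X ^ r₀ * ((1 + X) ^ k * PowerSeries.subst Z (H : IwasawaAlgebra p)) ≠ 0 := fun h ↦ by
  have hord := order_normShape hZ hu hH0 r₀ k
  rw [h, order_zero] at hord
  exact WithTop.top_ne_natCast r₀ hord

/-- **THE FUNCTIONAL-EQUATION SQUEEZE IN THE NORM COORDINATE (onto locus).** `p` odd (`2r = −1`, `S = T(1+T)^r`, `Z = T + ιT`);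
`L = u·T^{r₀}·(1+T)^k·H(Z)` with `u ∈ Λˣ`, `H ∈ ℤ_p[Z]` DISTINGUISHED and IRREDUCIBLE of degree `k`, `H(0) ≠ 0`; `g` with `T^{r₀} ∣ g ∣ L`,
`(ιg) = (g)` and `p ∣ coeff_{r₀} g`. THEN **`(g) = (L)`**. (Kato reading `μ(g) = 0`, `ord g ≤ r₀`, `H_g ∣ H`; `T^{r₀} ∣ g` ⟹ `ord g = r₀`;
`H` irreducible ⟹ `H_g ∈ {1, H}`; `coeff_{r₀} g = H_g(0)·U_g(0)` and `p ∉ ℤ_pˣ` exclude `H_g = 1`.) The brick of crux 19601's squeeze with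
`hshape` (`(T − c₁)(T − c₂)`, `c_i ∈ ℤ_p`) replaced by irreducibility of the HALF-degree polynomial — no rational zero needed, any `k`.
[cite: KimBD2008MRL, Thm. 3.11 (p. 93)] [cite: Kobayashi2003, Thm. 4.1 (p. 8)] [cite: Washington1997, §7.1 (Thm. 7.3), §13.2] -/
theorem span_eq_of_normShape_of_irreducible (hr : 2 * r = -1) (hS : S = X * binomialSeries ℤ_[p] r) (hZ : Z = X + invol p X)
    {g L u : IwasawaAlgebra p} {r₀ : ℕ} {H : Polynomial ℤ_[p]} (hu : IsUnit u)
    (hH : H.IsDistinguishedAt (IsLocalRing.maximalIdeal ℤ_[p])) (hirr : Irreducible H) (hH0 : H.coeff 0 ≠ 0)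
    (hL : L = u * X ^ r₀ * ((1 + X) ^ H.natDegree * PowerSeries.subst Z (H : IwasawaAlgebra p)))
    (hXg : (X : IwasawaAlgebra p) ^ r₀ ∣ g) (hgL : g ∣ L) (hι : Ideal.span {invol p g} = Ideal.span {g})
    (hcoef : (p : ℤ_[p]) ∣ coeff r₀ g) :
    Ideal.span {g} = Ideal.span {L} := by
  -- the Weierstrass datum and norm form of `L`
  set PL : Polynomial ℤ_[p] := Polynomial.X ^ r₀ * ∑ i ∈ Finset.range (H.natDegree + 1),
      Polynomial.C (H.coeff i) * Polynomial.X ^ (2 * i) * (1 + Polynomial.X) ^ (H.natDegree - i) with hPLdef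
  obtain ⟨-, hQdist⟩ := normPoly_isDistinguishedAt hH
  have hPLdist : PL.IsDistinguishedAt (IsLocalRing.maximalIdeal ℤ_[p]) := (isDistinguishedAt_X_pow' r₀).mul hQdist
  have hPLcoe : (PL : IwasawaAlgebra p) = X ^ r₀ * (1 + X) ^ H.natDegree * PowerSeries.subst Z (H : IwasawaAlgebra p) := by
    rw [hPLdef, Polynomial.coe_mul, Polynomial.coe_pow, Polynomial.coe_X, coe_normPoly_eq hZ H, mul_assoc]
  clear_value PL
  have hLW : L = C ((p : ℤ_[p]) ^ 0) * (PL : IwasawaAlgebra p) * u := by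
    rw [pow_zero, map_one, one_mul, hPLcoe, hL]; ring
  have hL0 : L ≠ 0 := hL ▸ normShape_ne_zero hZ hu hH0 r₀ H.natDegree
  have hrkL : (PowerSeries.order L).toNat = r₀ := by rw [hL, order_normShape hZ hu hH0]; rfl
  have hPHL : (PL : IwasawaAlgebra p) = X ^ (PowerSeries.order L).toNat * (1 + X) ^ H.natDegree *
      PowerSeries.subst Z (H : IwasawaAlgebra p) := by rw [hrkL]; exact hPLcoe
  -- the Weierstrass datum and norm form of `g`
  have hg0 : g ≠ 0 := by
    rintro rfl
    obtain ⟨q, hq⟩ := hgL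
    exact hL0 (by rw [hq, zero_mul])
  obtain ⟨Pg, Ug, hPg, hUg, -, hgW⟩ := exists_weierstrass_of_ne_zero hg0
  obtain ⟨Hg, hHg, -, hPHg, -⟩ := weierstrass_eq_X_pow_mul_normPoly_of_span_invol_eq hr hS hZ hg0 hι hPg hUg hgW
  -- the Kato reading with `n = 0`
  have hgL' : g ∣ C ((p : ℤ_[p]) ^ 0) * L := by rwa [pow_zero, map_one, one_mul]
  obtain ⟨hmu, hro, hHdvd⟩ := (normForm_dvd_C_pow_mul_iff hr hS hZ hPg hPLdist hUg hu hgW hLW hHg hH hPHg hPHL 0).mp hgL'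
  have hmu0 : mu g = 0 := by omega
  -- `T^{r₀} ∣ g` ⟹ `ord g = r₀`
  have hro' : (PowerSeries.order g).toNat = (PowerSeries.order L).toNat := by
    refine le_antisymm hro ?_
    rw [hrkL]
    obtain ⟨q, hq⟩ := hXg
    have h1 : ((r₀ : ℕ) : ℕ∞) ≤ PowerSeries.order g := by rw [hq, order_mul, order_X_pow]; exact le_self_add
    have h2 : PowerSeries.order g ≠ ⊤ := (order_finite_iff_ne_zero.mpr hg0).ne
    simpa using ENat.toNat_le_toNat h1 h2
  -- `H_g ∈ {1, H}`; the digit excludes `1`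
  rcases eq_one_or_eq_of_monic_dvd_irreducible hHg.monic hH.monic hirr hHdvd with h1 | hHeq
  · exfalso
    have hc := coeff_order_eq_of_normForm hZ hgW hPHg
    rw [hro', hrkL, hmu0, pow_zero, one_mul, h1, Polynomial.coeff_one_zero, one_mul] at hc
    rw [hc] at hcoef
    exact TowerSqrt.not_isUnit_p p (isUnit_of_dvd_unit hcoef (PowerSeries.isUnit_iff_constantCoeff.mp hUg))
  · exact (normForm_span_eq_iff hr hS hZ hPg hPLdist hUg hu hgW hLW hHg hH hPHg hPHL).mpr ⟨hmu0, hro', hHeq⟩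

/-- **THE SQUEEZE WITH SLACK `pⁿ` (off the onto locus): `(g) = (p^{μ(g)}·L)`.** Same `L = u·T^{r₀}·(1+T)^k·H(Z)` (`H` irreducible, `H(0) ≠ 0`);
`g` with `T^{r₀} ∣ g`, `g ∣ pⁿ·L` (Kobayashi Thm. 4.1 with its structural slack on crux 19606's rows), `(ιg) = (g)`, and ONE ALGEBRAIC ZERO PAIR
`ord_T g < λ(g)` (in place of the digit). THEN `μ(g) ≤ n`, `ord_T g = r₀`, **`λ(g) = r₀ + 2k`** and **`(g) = (p^{μ(g)}·L)`**: the main conjecture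
at the row holds UP TO THE POWER `p^{μ(g)}`. [cite: Kobayashi2003, Thm. 4.1 (p. 8)] [cite: KimBD2008MRL, Thm. 3.11 (p. 93)]
[cite: GreenbergVatsal2000, p. 4 (after Thm. (1.2))] [cite: Washington1997, §7.1 (Thm. 7.3), §13.2] -/
theorem span_eq_C_pow_mul_of_normShape_of_irreducible_of_lt_lam (hr : 2 * r = -1) (hS : S = X * binomialSeries ℤ_[p] r)
    (hZ : Z = X + invol p X) {g L u : IwasawaAlgebra p} {r₀ : ℕ} {H : Polynomial ℤ_[p]} (hu : IsUnit u)
    (hH : H.IsDistinguishedAt (IsLocalRing.maximalIdeal ℤ_[p])) (hirr : Irreducible H) (hH0 : H.coeff 0 ≠ 0)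
    (hL : L = u * X ^ r₀ * ((1 + X) ^ H.natDegree * PowerSeries.subst Z (H : IwasawaAlgebra p)))
    (hXg : (X : IwasawaAlgebra p) ^ r₀ ∣ g) {n : ℕ} (hgL : g ∣ C ((p : ℤ_[p]) ^ n) * L)
    (hι : Ideal.span {invol p g} = Ideal.span {g}) (hlam : r₀ < lam g) :
    mu g ≤ n ∧ (PowerSeries.order g).toNat = r₀ ∧ lam g = r₀ + 2 * H.natDegree ∧
      Ideal.span {g} = Ideal.span {C ((p : ℤ_[p]) ^ mu g) * L} := by
  -- the Weierstrass datum and norm form of `L`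
  set PL : Polynomial ℤ_[p] := Polynomial.X ^ r₀ * ∑ i ∈ Finset.range (H.natDegree + 1),
      Polynomial.C (H.coeff i) * Polynomial.X ^ (2 * i) * (1 + Polynomial.X) ^ (H.natDegree - i) with hPLdef
  obtain ⟨hQdeg, hQdist⟩ := normPoly_isDistinguishedAt hH
  have hPLdist : PL.IsDistinguishedAt (IsLocalRing.maximalIdeal ℤ_[p]) := (isDistinguishedAt_X_pow' r₀).mul hQdist
  have hPLdeg : PL.natDegree = r₀ + 2 * H.natDegree := by
    rw [hPLdef, (Polynomial.monic_X_pow r₀).natDegree_mul hQdist.monic, Polynomial.natDegree_X_pow, hQdeg]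
  have hPLcoe : (PL : IwasawaAlgebra p) = X ^ r₀ * (1 + X) ^ H.natDegree * PowerSeries.subst Z (H : IwasawaAlgebra p) := by
    rw [hPLdef, Polynomial.coe_mul, Polynomial.coe_pow, Polynomial.coe_X, coe_normPoly_eq hZ H, mul_assoc]
  clear_value PL
  have hLW : L = C ((p : ℤ_[p]) ^ 0) * (PL : IwasawaAlgebra p) * u := by
    rw [pow_zero, map_one, one_mul, hPLcoe, hL]; ring
  have hL0 : L ≠ 0 := hL ▸ normShape_ne_zero hZ hu hH0 r₀ H.natDegree
  have hrkL : (PowerSeries.order L).toNat = r₀ := by rw [hL, order_normShape hZ hu hH0]; rfl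
  have hPHL : (PL : IwasawaAlgebra p) = X ^ (PowerSeries.order L).toNat * (1 + X) ^ H.natDegree *
      PowerSeries.subst Z (H : IwasawaAlgebra p) := by rw [hrkL]; exact hPLcoe
  -- the Weierstrass datum and norm form of `g`
  have hpL0 : C ((p : ℤ_[p]) ^ n) * L ≠ 0 := mul_ne_zero (Summit.BirchSwinnertonDyer.Rank1Residual.X1.MuLambda.C_pow_ne_zero n) hL0
  have hg0 : g ≠ 0 := by
    rintro rfl
    obtain ⟨q, hq⟩ := hgL
    exact hpL0 (by rw [hq, zero_mul])
  obtain ⟨Pg, Ug, hPg, hUg, hdegPg, hgW⟩ := exists_weierstrass_of_ne_zero hg0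
  generalize hm : mu g = m at hgW ⊢
  obtain ⟨Hg, hHg, -, hPHg, hPgdeg⟩ := weierstrass_eq_X_pow_mul_normPoly_of_span_invol_eq hr hS hZ hg0 hι hPg hUg hgW
  -- the Kato reading with slack `n`
  obtain ⟨hmu, hro, hHdvd⟩ := (normForm_dvd_C_pow_mul_iff hr hS hZ hPg hPLdist hUg hu hgW hLW hHg hH hPHg hPHL n).mp hgL
  -- `T^{r₀} ∣ g` ⟹ `ord g = r₀`
  have hro' : (PowerSeries.order g).toNat = (PowerSeries.order L).toNat := by
    refine le_antisymm hro ?_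
    rw [hrkL]
    obtain ⟨q, hq⟩ := hXg
    have h1 : ((r₀ : ℕ) : ℕ∞) ≤ PowerSeries.order g := by rw [hq, order_mul, order_X_pow]; exact le_self_add
    have h2 : PowerSeries.order g ≠ ⊤ := (order_finite_iff_ne_zero.mpr hg0).ne
    simpa using ENat.toNat_le_toNat h1 h2
  rw [hrkL] at hro'
  -- `H_g ∈ {1, H}`; one algebraic zero pair excludes `1`
  rcases eq_one_or_eq_of_monic_dvd_irreducible hHg.monic hH.monic hirr hHdvd with h1 | hHeq
  · exfalso
    rw [hro', h1, Polynomial.natDegree_one, mul_zero, add_zero] at hPgdeg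
    rw [hPgdeg] at hdegPg
    omega
  · have hPP : Pg = PL := by
      apply Polynomial.coe_injective
      rw [hPHg, hPLcoe, hro', hHeq]
    have hpL : C ((p : ℤ_[p]) ^ m) * L = C ((p : ℤ_[p]) ^ m) * (PL : IwasawaAlgebra p) * u := by rw [hL, hPLcoe]; ring
    refine ⟨by omega, hro', by rw [← hdegPg, hPP, hPLdeg], ?_⟩
    have e1 : Associated (C ((p : ℤ_[p]) ^ m) * (PL : IwasawaAlgebra p)) (C ((p : ℤ_[p]) ^ m) * (PL : IwasawaAlgebra p) * Ug) :=
      associated_mul_unit_right _ Ug hUg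
    have e2 : Associated (C ((p : ℤ_[p]) ^ m) * (PL : IwasawaAlgebra p)) (C ((p : ℤ_[p]) ^ m) * (PL : IwasawaAlgebra p) * u) :=
      associated_mul_unit_right _ u hu
    rw [hgW, hPP, hpL]
    exact Ideal.span_singleton_eq_span_singleton.mpr (e1.symm.trans e2)

/-! ## §106 `k = 1`: the shape `Lη = u·T^{r₀}·(T² + aT + a)`, `a ∈ pℤ_p ∖ {0}` — no `c₁, c₂` -/

/-- `Z + a` (`a ∈ pℤ_p`) is distinguished of degree `1`. [cite: Washington1997, §7.1] -/
theorem isDistinguishedAt_X_add_C {a : ℤ_[p]} (ha : (p : ℤ_[p]) ∣ a) :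
    (Polynomial.X + Polynomial.C a : Polynomial ℤ_[p]).IsDistinguishedAt (IsLocalRing.maximalIdeal ℤ_[p]) := by
  refine ⟨⟨fun {n} hn ↦ ?_⟩, Polynomial.monic_X_add_C a⟩
  rw [Polynomial.natDegree_X_add_C] at hn
  have hn0 : n = 0 := by omega
  subst hn0
  rw [Polynomial.coeff_add, Polynomial.coeff_X_zero, Polynomial.coeff_C_zero, zero_add, PadicInt.maximalIdeal_eq_span_p,
    Ideal.mem_span_singleton]
  exact ha

/-- **`(1+T)·(Z + a) = T² + aT + a`** (`Z = T + ιT`, `(1+T)Z = T²`): the norm form of the `k = 1` Weierstrass polynomial (Part XVII's shape).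
[cite: Washington1997, §13.2] -/
theorem one_add_X_mul_subst_X_add_C (hZ : Z = X + invol p X) (a : ℤ_[p]) :
    (1 + X) ^ (Polynomial.X + Polynomial.C a : Polynomial ℤ_[p]).natDegree *
        PowerSeries.subst Z ((Polynomial.X + Polynomial.C a : Polynomial ℤ_[p]) : IwasawaAlgebra p) =
      X ^ 2 + C a * X + C a := by
  have hZ' := hasSubst_trace hZ
  rw [Polynomial.natDegree_X_add_C, pow_one, Polynomial.coe_add, Polynomial.coe_X, Polynomial.coe_C, subst_add hZ', subst_X hZ',
    subst_C_eq, mul_add, hZ, one_add_X_mul_X_add_invol_X]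
  ring

/-- **THE `k = 1` SQUEEZE WITHOUT RATIONAL ZEROS: `Lη = u·T^{r₀}·(T² + aT + a)`, `a ∈ pℤ_p ∖ {0}`, `T^{r₀} ∣ g ∣ Lη`, `(ιg) = (g)`, `p ∣ coeff_{r₀} g`
⟹ `(g) = (Lη)`** (`p` odd). Crux 19601's `span_singleton_eq_of_invol_of_feShape` asks for `(T − c₁)(T − c₂)` with `c_i ∈ pℤ_p ∖ {0}`; since the
Weierstrass polynomial of `L_p⁺(V, η, X)` at `λ = r₀ + 2` is ALWAYS `T^{r₀}(T² + aT + a)` (Part XVII), this version covers every such row, including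
the 12/19 level-4 rows of P-30Z where `T² + aT + a` is irreducible over `ℚ_5`. [cite: KimBD2008MRL, Thm. 3.11 (p. 93)] [cite: Kobayashi2003, Thm. 4.1 (p. 8)]
[cite: Washington1997, §7.1 (Thm. 7.3), §13.2] -/
theorem span_eq_of_quadraticShape (hp2 : p ≠ 2) {g L u : IwasawaAlgebra p} {r₀ : ℕ} {a : ℤ_[p]} (hu : IsUnit u) (ha : (p : ℤ_[p]) ∣ a)
    (ha0 : a ≠ 0) (hL : L = u * X ^ r₀ * (X ^ 2 + C a * X + C a))
    (hXg : (X : IwasawaAlgebra p) ^ r₀ ∣ g) (hgL : g ∣ L) (hι : Ideal.span {invol p g} = Ideal.span {g}) (hcoef : (p : ℤ_[p]) ∣ coeff r₀ g) :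
    Ideal.span {g} = Ideal.span {L} := by
  obtain ⟨r, hr⟩ := exists_two_mul_eq_neg_one (p := p) hp2
  have hH := isDistinguishedAt_X_add_C ha
  have hirr : Irreducible (Polynomial.X + Polynomial.C a : Polynomial ℤ_[p]) := by
    simpa using (Polynomial.prime_X_sub_C (-a)).irreducible
  have hH0 : (Polynomial.X + Polynomial.C a : Polynomial ℤ_[p]).coeff 0 ≠ 0 := by
    rwa [Polynomial.coeff_add, Polynomial.coeff_X_zero, Polynomial.coeff_C_zero, zero_add]
  refine span_eq_of_normShape_of_irreducible hr (S := X * binomialSeries ℤ_[p] r) rfl (Z := X + invol p X) rfl hu hH hirr hH0 ?_ hXg hgL hι hcoef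
  rw [hL, one_add_X_mul_subst_X_add_C rfl]

end Summit.BirchSwinnertonDyer.BirchSwinnertonDyer.Theorems.EtaThetaFunctionalEquation

end
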